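import Summits.NavierStokesRegularity.NavierStokesRegularity.Theses.AxisymmetricExtremality
import Summits.NavierStokesRegularity.NavierStokesRegularity.Theorems.AxisymmetricExtremalityMinimalDatumPFoldNotAeZero
import Summits.NavierStokesRegularity.NavierStokesRegularity.Theorems.AxisymmetricExtremalityMinimalDatumPFoldConcentrationWeakLimitBlowup
import Literature.Analysis.FluidPDE.KatoFarFieldBound
import Literature.Analysis.FluidPDE.KatoViscosityScaling
import Literature.Analysis.FluidPDE.KatoLocalCovariance
import Literature.Analysis.FluidPDE.KatoMaximalTime
import Literature.Analysis.FluidPDE.HomSobolevRepresentedL3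
import HarnessLib

/-!
# Route AxisymmetricExtremality — crux `MinimalDatumPFold` (stmt-NavierStokesRegularity-15452), stub `stub_branchOfAxisymMinimalDatum`

Registered stub of the line `Sketch` (`Cruxes/MinimalDatumPFold/Lines/Sketch.lean`, lead c2): the
DOMINANCE converse of the re-typing of the crux's sub-threshold branch as parabolic concentration.
An exactly axisymmetric Rusin–Šverák minimal blow-up datum `(u₀, g)` at viscosity `ν > 0` yields
exactly axisymmetric SUB-threshold data `U k` (classes `G k`, `‖G k‖ < ρ_max^pure(ν)`) whose Kato
solutions `u k` on `[0, 1)` concentrate at `(1, x k)` (the essential suprema of `|u k|` on every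
backward cylinder `Q_r(1, x k)` tend to `∞`). Target tree file:
`Summits/NavierStokesRegularity/NavierStokesRegularity/Theorems/AxisymmetricExtremalityMinimalDatumPFoldBranchOfAxisymMinimalDatum.lean`.

Proof. Unit viscosity (`branchOfAxisym_unit`): `(ψ, gψ) ∈ M(1)` has a Kato solution `w` on
`[0, T)` singular at `(T, x_*)` (**N**); the data `c_k ψ`, `c_k = 1 - 1/(k+1)`, with classes
`c_k gψ` of norm `< ‖gψ‖ = ρ_max^pure(1)` (`‖gψ‖ ≠ 0` by `stub_minimalDatum_not_aeZero`) have global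
Kato solutions, which CONCENTRATE at `(T, x_*)`: were a subsequence bounded by `b` on
`Q_r(T, x_*)`, so would be its Leray solutions (**E**, **W**), which converge in `L³` near the
cylinder to a Leray solution of `ψ` (**K**, as `c_k gψ ⇀ gψ`), a.e. equal to `w` below `T` (**W**),
hence unbounded there — but `L³`-limits of functions bounded by `b` are bounded by `b`
(`branchOfAxisym_not_bounded`). General `ν`: scale the datum to unit viscosity
(`IsMinimalBlowupDatum.inv_smul`) and transfer the unit sequence back by `u ↦ ν u(ν ·)` and the
parabolic dilation `λ = √(T/ν)` without translation (`branchOfAxisym_kato_transfer`), which keeps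
axisymmetry and transports concentration and classes.

Reference: W. Rusin, V. Šverák, J. Funct. Anal. 260 (2011) 879–891 = arXiv:0911.0500, §4 p. 6,
Thm. 4.1, Thm. 4.2, proof of Cor. 4.3 (p. 8) [RusinSverak2011].
-/

set_option linter.dupNamespace false

noncomputable section

open MeasureTheory TopologicalSpace Set Function Filter Topology Metric
open scoped ENNReal NNReal InnerProductSpace

namespace Summit.NavierStokesRegularity.NavierStokesRegularity.Theorems

open Literature.Analysis.FluidPDE Literature.Analysis.FunctionSpaces
open Literature.Analysis.FunctionSpaces.EuclideanSpace (complexify)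

/-- Scalar multiples commute with the rotations about the vertical axis (written out in
coordinates as in the crux). [folklore] -/
theorem branchOfAxisym_smul_rot (s θ : ℝ) (v : EuclideanSpace ℝ (Fin 3)) :
    s • (WithLp.toLp 2 ![Real.cos θ * v 0 - Real.sin θ * v 1,
        Real.sin θ * v 0 + Real.cos θ * v 1, v 2] : EuclideanSpace ℝ (Fin 3)) =
      WithLp.toLp 2 ![Real.cos θ * (s • v) 0 - Real.sin θ * (s • v) 1,
        Real.sin θ * (s • v) 0 + Real.cos θ * (s • v) 1, (s • v) 2] := by
  ext i
  fin_cases i <;> simp <;> ring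

/-- Exact axisymmetry about the vertical axis passes from `U` to every field `y ↦ a • U (b • y)`
(the rotations are linear). [folklore] -/
theorem branchOfAxisym_axisym_of_smul {U : EuclideanSpace ℝ (Fin 3) → EuclideanSpace ℝ (Fin 3)}
    (hU : ∀ (θ : ℝ) (y : EuclideanSpace ℝ (Fin 3)),
      U (WithLp.toLp 2 ![Real.cos θ * y 0 - Real.sin θ * y 1, Real.sin θ * y 0 + Real.cos θ * y 1, y 2]) =
        WithLp.toLp 2 ![Real.cos θ * U y 0 - Real.sin θ * U y 1,
          Real.sin θ * U y 0 + Real.cos θ * U y 1, U y 2])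
    (a b : ℝ) (V : EuclideanSpace ℝ (Fin 3) → EuclideanSpace ℝ (Fin 3))
    (hV : ∀ y, V y = a • U (b • y)) (θ : ℝ) (y : EuclideanSpace ℝ (Fin 3)) :
    V (WithLp.toLp 2 ![Real.cos θ * y 0 - Real.sin θ * y 1, Real.sin θ * y 0 + Real.cos θ * y 1, y 2]) =
      WithLp.toLp 2 ![Real.cos θ * V y 0 - Real.sin θ * V y 1,
        Real.sin θ * V y 0 + Real.cos θ * V y 1, V y 2] := by
  rw [hV, hV, branchOfAxisym_smul_rot b θ y, hU θ (b • y)]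
  exact branchOfAxisym_smul_rot a θ (U (b • y))

/-- An `L³`-limit of functions essentially bounded by `b` is essentially bounded by `b`:
`(‖g‖ - b)₊ ≤ ‖f n - g‖` a.e. forces `∫ (‖g‖ - b)₊³ = 0`. [folklore] -/
theorem branchOfAxisym_ae_enorm_le_of_tendsto_lintegral {α F : Type*} [MeasurableSpace α]
    [NormedAddCommGroup F] {μ : Measure α} {f : ℕ → α → F} {g : α → F}
    (hg : AEStronglyMeasurable g μ) {b : ℝ≥0∞} (hf : ∀ n, ∀ᵐ z ∂μ, ‖f n z‖ₑ ≤ b)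
    (hlim : Tendsto (fun n => ∫⁻ z, ‖f n z - g z‖ₑ ^ (3 : ℕ) ∂μ) atTop (𝓝 0)) :
    ∀ᵐ z ∂μ, ‖g z‖ₑ ≤ b := by
  have hle : ∀ n, ∫⁻ z, (‖g z‖ₑ - b) ^ (3 : ℕ) ∂μ ≤ ∫⁻ z, ‖f n z - g z‖ₑ ^ (3 : ℕ) ∂μ := fun n =>
    lintegral_mono_ae ((hf n).mono fun z hz => by
      gcongr
      rw [tsub_le_iff_left]
      calc ‖g z‖ₑ = ‖f n z - (f n z - g z)‖ₑ := by rw [sub_sub_cancel]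
        _ ≤ ‖f n z‖ₑ + ‖f n z - g z‖ₑ := enorm_sub_le
        _ ≤ b + ‖f n z - g z‖ₑ := by gcongr)
  have h0 : ∫⁻ z, (‖g z‖ₑ - b) ^ (3 : ℕ) ∂μ = 0 := le_antisymm (ge_of_tendsto' hlim hle) zero_le
  have hmeas : AEMeasurable (fun z => (‖g z‖ₑ - b) ^ (3 : ℕ)) μ :=
    (hg.enorm.sub aemeasurable_const).pow_const _
  rw [lintegral_eq_zero_iff' hmeas] at h0
  filter_upwards [h0] with z hz
  exact tsub_eq_zero_iff_le.1 ((pow_eq_zero_iff (n := 3) (by norm_num)).1 hz)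

/-- The sub-threshold scalings of a unit-viscosity minimal blow-up datum: for `0 ≤ c < 1`, `c • ψ`
is an `L³`, weakly divergence-free datum represented by `c • gψ`, of norm `c ‖gψ‖ < ‖gψ‖ =
ρ_max^pure(1)` — `‖gψ‖ ≠ 0` since `ψ` is not a.e. zero (`stub_minimalDatum_not_aeZero`).
[cite: RusinSverak2011, Cor. 4.3 (arXiv:0911.0500 p. 8, the set M)] -/
theorem branchOfAxisym_subthreshold {ψ : EuclideanSpace ℝ (Fin 3) → EuclideanSpace ℝ (Fin 3)}
    {gψ : HomSobolev (EuclideanSpace ℝ (Fin 3)) (EuclideanSpace ℂ (Fin 3)) (1 / 2 : ℝ)}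
    (hmin : IsMinimalBlowupDatum 1 ψ gψ) {c : ℝ} (hc0 : 0 ≤ c) (hc1 : c < 1) :
    MemLp (c • ψ) 3 volume ∧ (((c : ℝ) : ℂ) • gψ).Represents (complexify ∘ (c • ψ)) ∧
      IsWeaklyDivFree (c • ψ) ∧ ‖((c : ℝ) : ℂ) • gψ‖ₑ < rusinSverakRhoMaxPure 1 := by
  obtain ⟨h3, hrep, hdiv, hnorm, -⟩ := id hmin
  refine ⟨h3.const_smul _, represents_complexify_smul hrep c, hdiv.const_smul c, ?_⟩
  have hρ0 : ‖gψ‖ₑ ≠ 0 := by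
    intro h0
    obtain rfl : gψ = 0 := enorm_eq_zero.1 h0
    exact stub_minimalDatum_not_aeZero 1 ψ 0 hmin ((hrep.ae_eq HomSobolev.represents_zero).mono
      fun x hx => EuclideanSpace.complexify_injective (by simpa using hx))
  rw [enorm_real_smul_homSobolev hc0, ← hnorm]
  calc ENNReal.ofReal c * ‖gψ‖ₑ < 1 * ‖gψ‖ₑ :=
      ENNReal.mul_lt_mul_left hρ0 enorm_ne_top (ENNReal.ofReal_lt_one.2 hc1)
    _ = ‖gψ‖ₑ := one_mul _

/-- **No uniform bound near the singular point** (unit viscosity). If `ψ` (`L³`, weakly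
divergence free, represented by `gψ`) has a Kato solution `w` on `[0, T)` singular at `(T, x_*)`,
and `v k` are Kato solutions on `[0, T)` of data `V k` whose `Ḣ^{1/2}`-bounded classes `g k ⇀ gψ`,
then the `v k` are not uniformly essentially bounded on a cylinder `Q_r(T, x_*)`, `r² < T`: their
Leray solutions (**E**) agree with them below `T` (**W**) and converge in `L³` near the cylinder,
along a subsequence, to a Leray solution of `ψ` (**K**), which agrees with `w` below `T` (**W**)
and is unbounded on `Q_r(T, x_*)` — but `L³`-limits of functions bounded by `b` are bounded by
`b`. [cite: RusinSverak2011, Thm. 4.1, Thm. 4.2 and proof of Cor. 4.3 (arXiv:0911.0500 pp. 6–8)] -/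
theorem branchOfAxisym_not_bounded {T : ℝ} (hT : 0 < T)
    {ψ : EuclideanSpace ℝ (Fin 3) → EuclideanSpace ℝ (Fin 3)}
    {gψ : HomSobolev (EuclideanSpace ℝ (Fin 3)) (EuclideanSpace ℂ (Fin 3)) (1 / 2 : ℝ)}
    (h3 : MemLp ψ 3 volume) (hrep : gψ.Represents (complexify ∘ ψ)) (hdiv : IsWeaklyDivFree ψ)
    {w : ℝ → EuclideanSpace ℝ (Fin 3) → EuclideanSpace ℝ (Fin 3)} (hw : IsKatoSolutionOn T 1 ψ w)
    {xs : EuclideanSpace ℝ (Fin 3)}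
    (hsing : ∀ r : ℝ, 0 < r →
      eLpNorm (uncurry w) ∞ (volume.restrict (parabolicCylinder r ((T : ℝ), xs))) = ∞)
    {V : ℕ → EuclideanSpace ℝ (Fin 3) → EuclideanSpace ℝ (Fin 3)}
    {g : ℕ → HomSobolev (EuclideanSpace ℝ (Fin 3)) (EuclideanSpace ℂ (Fin 3)) (1 / 2 : ℝ)}
    {v : ℕ → ℝ → EuclideanSpace ℝ (Fin 3) → EuclideanSpace ℝ (Fin 3)}
    (hV : ∀ k, MemLp (V k) 3 volume ∧ (g k).Represents (complexify ∘ V k) ∧ IsWeaklyDivFree (V k))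
    (hbdd : ∃ R : ℝ, ∀ k, ‖g k‖ ≤ R)
    (hweak : ∀ w', Tendsto (fun n => ⟪g n, w'⟫_ℂ) atTop (𝓝 ⟪gψ, w'⟫_ℂ))
    (hv : ∀ k, IsKatoSolutionOn T 1 (V k) (v k))
    {r : ℝ} (hr : 0 < r) (hrT : r ^ 2 < T) {b : ℝ≥0}
    (hb : ∀ k, eLpNorm (uncurry (v k)) ∞ (volume.restrict (parabolicCylinder r ((T : ℝ), xs))) ≤ b) :
    False := by
  -- E: Leray solutions of the `V k`; W: they agree with the Kato solutions below `T`
  choose W q hW using fun k => leray_solution_exists_of_memLp_three_holds (V k) (hV k).1 (hV k).2.2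
  have hae : ∀ k, uncurry (W k) =ᵐ[volume.restrict (Ioo 0 T ×ˢ (univ : Set (EuclideanSpace ℝ (Fin 3))))]
      uncurry (v k) := fun k =>
    leray_solution_ae_eq_kato_holds (V k) (hV k).1 (hV k).2.2 (W k) (q k) (hW k) T (v k) (hv k)
  -- K: a subsequence in the situation of Prop. 2.2 with a Leray solution of `ψ`, = `w` below `T` (W)
  obtain ⟨φ, -, ulim, plim, qq, hulim, hsit⟩ :=
    rusin_sverak_leray_weak_stability_holds V g W q hV hbdd hW gψ hweak ψ h3 hrep hdiv
  have hsingU : eLpNorm (uncurry ulim) ∞ (volume.restrict (parabolicCylinder r ((T : ℝ), xs))) = ∞ :=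
    eLpNorm_parabolicCylinder_eq_top_of_ae_eq hT
      (leray_solution_ae_eq_kato_holds ψ h3 hdiv ulim plim hulim T w hw) xs hsing hr
  -- the cylinder `Q`, inside the compact `[T - r², T] × B̄_r(xs) ⊆ (0, ∞) × ℝ³`
  set Q : Set (ℝ × EuclideanSpace ℝ (Fin 3)) := parabolicCylinder r ((T : ℝ), xs) with hQ_def
  have hQK : Q ⊆ Icc (T - r ^ 2) T ×ˢ closedBall xs r := prod_mono Ioo_subset_Icc_self ball_subset_closedBall
  have hKO : Icc (T - r ^ 2) T ×ˢ closedBall xs r ⊆ ((slab (EuclideanSpace ℝ (Fin 3)) (Ioi 0) isOpen_Ioi :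
      Opens (ℝ × EuclideanSpace ℝ (Fin 3))) : Set (ℝ × EuclideanSpace ℝ (Fin 3))) := fun z hz => by
    rw [coe_slab]
    exact ⟨show (0 : ℝ) < z.1 by linarith [hz.1.1], mem_univ _⟩
  have hQstrip : Q ⊆ Ioo 0 T ×ˢ (univ : Set (EuclideanSpace ℝ (Fin 3))) :=
    parabolicCylinder_subset_strip hrT.le le_rfl xs
  -- `L³(Q)` convergence of the Leray solutions to `ulim`
  have hlimQ : Tendsto (fun n => ∫⁻ z in Q, ‖W (φ n) z.1 z.2 - ulim z.1 z.2‖ₑ ^ (3 : ℕ)) atTop (𝓝 0) :=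
    tendsto_of_tendsto_of_tendsto_of_le_of_le tendsto_const_nhds
      (hsit.tendsto_lintegral _ hKO (isCompact_Icc.prod (isCompact_closedBall _ _)))
      (fun _ => zero_le) (fun _ => lintegral_mono_set hQK)
  -- the Leray solutions are bounded by `b` a.e. on `Q`, hence so is `ulim`: contradiction
  have hbW : ∀ n, ∀ᵐ z ∂(volume.restrict Q), ‖uncurry (W (φ n)) z‖ₑ ≤ b := fun n => by
    have h1 : eLpNorm (uncurry (W (φ n))) ∞ (volume.restrict Q) ≤ b := by
      rw [eLpNorm_congr_ae (ae_restrict_of_ae_restrict_of_subset hQstrip (hae (φ n)))]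
      exact hb (φ n)
    rw [eLpNorm_exponent_top] at h1
    exact (enorm_ae_le_eLpNormEssSup _ _).mono fun z hz => hz.trans h1
  have hQslab : Q ⊆ Ioi (0 : ℝ) ×ˢ (univ : Set (EuclideanSpace ℝ (Fin 3))) := fun z hz =>
    ⟨(hQstrip hz).1.1, mem_univ _⟩
  have hbU : ∀ᵐ z ∂(volume.restrict Q), ‖uncurry ulim z‖ₑ ≤ b :=
    branchOfAxisym_ae_enorm_le_of_tendsto_lintegral (f := fun n => uncurry (W (φ n))) (g := uncurry ulim)
      (hulim.aestronglyMeasurable.mono_measure (Measure.restrict_mono hQslab le_rfl)) hbW hlimQ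
  have hlt : eLpNorm (uncurry ulim) ∞ (volume.restrict Q) < ∞ := by
    rw [eLpNorm_exponent_top]
    exact (eLpNormEssSup_le_of_ae_enorm_bound hbU).trans_lt ENNReal.coe_lt_top
  exact hlt.ne hsingU

/-- **The stub at unit viscosity, at the blow-up time `T`.** A unit-viscosity minimal blow-up
datum `(ψ, gψ)` has a Kato solution on some `[0, T)` singular at some `(T, x_*)` (**N**); the
sub-threshold data `c_k ψ`, `c_k = 1 - 1/(k+1)`, represented by `c_k gψ` (bounded by `‖gψ‖`,
convergent to `gψ`), have global Kato solutions, whose restrictions to `[0, T)` concentrate at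
`(T, x_*)`: for `r² < T`, otherwise some level is not exceeded along a subsequence
(`Filter.extraction_of_frequently_atTop`), against `branchOfAxisym_not_bounded`; larger cylinders
contain smaller ones. [cite: RusinSverak2011, §4 p. 6 and proof of Cor. 4.3 (arXiv:0911.0500 pp. 6–8)] -/
theorem branchOfAxisym_unit {ψ : EuclideanSpace ℝ (Fin 3) → EuclideanSpace ℝ (Fin 3)}
    {gψ : HomSobolev (EuclideanSpace ℝ (Fin 3)) (EuclideanSpace ℂ (Fin 3)) (1 / 2 : ℝ)}
    (hmin : IsMinimalBlowupDatum 1 ψ gψ) :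
    ∃ T : ℝ, 0 < T ∧ ∃ (xs : EuclideanSpace ℝ (Fin 3)) (cseq : ℕ → ℝ)
      (u : ℕ → ℝ → EuclideanSpace ℝ (Fin 3) → EuclideanSpace ℝ (Fin 3)),
      (∀ k, MemLp (cseq k • ψ) 3 volume ∧
        (((cseq k : ℝ) : ℂ) • gψ).Represents (complexify ∘ (cseq k • ψ)) ∧
        IsWeaklyDivFree (cseq k • ψ) ∧ ‖((cseq k : ℝ) : ℂ) • gψ‖ₑ < rusinSverakRhoMaxPure 1) ∧
      (∀ k, IsKatoSolutionOn T 1 (cseq k • ψ) (u k)) ∧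
      ∀ r : ℝ, 0 < r → Tendsto (fun k => eLpNorm (uncurry (u k)) ∞
        (volume.restrict (parabolicCylinder r ((T : ℝ), xs)))) atTop (𝓝 ∞) := by
  obtain ⟨h3, hrep, hdiv, -, hnot⟩ := id hmin
  -- N: a Kato solution of `ψ` on `[0, T)` singular at `(T, xs)`
  obtain ⟨T, hT, xs, w, hmild, hcont, h0, hmeas, hsing⟩ :=
    rusin_sverak_singular_point_of_blowup_holds ψ gψ h3 hrep hdiv hnot
  have hw : IsKatoSolutionOn T 1 ψ w := ⟨hmild, hcont, h0, hmeas⟩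
  -- the factors `c_k = 1 - 1/(k+1) ↑ 1` and the sub-threshold data
  set cseq : ℕ → ℝ := fun k => 1 - 1 / ((k : ℝ) + 1) with hcseq
  have hc01 : ∀ k : ℕ, 0 ≤ cseq k ∧ cseq k < 1 := fun k => by
    have hk : (0 : ℝ) < (k : ℝ) + 1 := Nat.cast_add_one_pos k
    have h2 : 1 / ((k : ℝ) + 1) ≤ 1 := (div_le_one hk).2 (by linarith [k.cast_nonneg (α := ℝ)])
    exact ⟨by simp only [hcseq]; linarith, by simp only [hcseq]; linarith [one_div_pos.2 hk]⟩
  have hc1 : Tendsto cseq atTop (𝓝 1) := by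
    have h := (tendsto_const_nhds (x := (1 : ℝ))).sub (tendsto_one_div_add_atTop_nhds_zero_nat (𝕜 := ℝ))
    rwa [sub_zero] at h
  have hdata := fun k => branchOfAxisym_subthreshold hmin (hc01 k).1 (hc01 k).2
  have hbddk : ∀ k, ‖((cseq k : ℝ) : ℂ) • gψ‖ ≤ ‖gψ‖ := fun k => by
    rw [norm_smul, Complex.norm_real, Real.norm_of_nonneg (hc01 k).1]
    exact mul_le_of_le_one_left (norm_nonneg _) (hc01 k).2.le
  have hweak : ∀ w', Tendsto (fun n => ⟪((cseq n : ℝ) : ℂ) • gψ, w'⟫_ℂ) atTop (𝓝 ⟪gψ, w'⟫_ℂ) := by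
    intro w'
    have h2 := ((Complex.continuous_ofReal.tendsto 1).comp hc1).mul_const ⟪gψ, w'⟫_ℂ
    rw [Complex.ofReal_one, one_mul] at h2
    simpa only [Function.comp_apply, inner_smul_left, Complex.conj_ofReal] using h2
  -- global Kato solutions of the sub-threshold data, restricted to `[0, T)`
  have hglob : ∀ k : ℕ, HasGlobalKatoSolution 1 (cseq k • ψ) := fun k =>
    hasGlobalKatoSolution_of_lt_rusinSverakRhoMaxPure (hdata k).1 (hdata k).2.1 (hdata k).2.2.1
      (hdata k).2.2.2
  choose u hu using fun k => (hglob k).exists_isKatoSolutionOn T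
  refine ⟨T, hT, xs, cseq, u, hdata, hu, fun r hr => ?_⟩
  -- concentration at `(T, xs)`: small radii by contradiction, then monotonicity
  have key : ∀ ρ : ℝ, 0 < ρ → ρ ^ 2 < T → Tendsto (fun k => eLpNorm (uncurry (u k)) ∞
      (volume.restrict (parabolicCylinder ρ ((T : ℝ), xs)))) atTop (𝓝 ∞) := by
    intro ρ hρ hρT
    by_contra hnot
    simp only [ENNReal.tendsto_nhds_top_iff_nnreal, not_forall, not_eventually, not_lt] at hnot
    obtain ⟨b, hb⟩ := hnot
    obtain ⟨φ, hφ, hφb⟩ := extraction_of_frequently_atTop hb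
    exact branchOfAxisym_not_bounded hT h3 hrep hdiv hw hsing (V := fun n => cseq (φ n) • ψ)
      (g := fun n => ((cseq (φ n) : ℝ) : ℂ) • gψ)
      (fun n => ⟨(hdata (φ n)).1, (hdata (φ n)).2.1, (hdata (φ n)).2.2.1⟩) ⟨‖gψ‖, fun n => hbddk (φ n)⟩
      (fun w' => (hweak w').comp hφ.tendsto_atTop) (fun n => hu (φ n)) hρ hρT hφb
  set ρ : ℝ := min r (Real.sqrt (T / 2)) with hρ_def
  have hρ : 0 < ρ := lt_min hr (Real.sqrt_pos.2 (half_pos hT))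
  have hρr : ρ ≤ r := min_le_left _ _
  have hρT : ρ ^ 2 < T := by
    calc ρ ^ 2 ≤ Real.sqrt (T / 2) ^ 2 := pow_le_pow_left₀ hρ.le (min_le_right _ _) 2
      _ = T / 2 := Real.sq_sqrt (half_pos hT).le
      _ < T := half_lt_self hT
  have hmonoQ : parabolicCylinder ρ ((T : ℝ), xs) ⊆ parabolicCylinder r ((T : ℝ), xs) := by
    have h2 : ρ ^ 2 ≤ r ^ 2 := pow_le_pow_left₀ hρ.le hρr 2
    exact prod_mono (Ioo_subset_Ioo (by linarith) le_rfl) (ball_subset_ball hρr)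
  exact tendsto_nhds_top_mono' (key ρ hρ hρT) fun k =>
    eLpNorm_mono_measure (uncurry (u k)) (Measure.restrict_mono hmonoQ le_rfl)

/-- **Transfer of a unit Kato solution on `[0, T)` to a viscosity-`ν` Kato solution on `[0, 1)`**:
viscosity scaling `u ↦ ν u(ν ·)` to `[0, T/ν)` (`IsMildNSSolutionOn.timeRescale`,
`ContinuousInLpOn.timeRescale`, `aestronglyMeasurable_comp_stAffine_Ioo`) followed by the parabolic
dilation `λ = √(T/ν)` without translation (`kato_local_rescale_translate`); the datum becomes
`y ↦ λ ν U(λ y)`. [cite: RusinSverak2011, §1 (arXiv:0911.0500 p. 3) and proof of Cor. 4.3 (p. 8)] -/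
theorem branchOfAxisym_kato_transfer {ν T : ℝ} (hν : 0 < ν) (hT : 0 < T)
    {U : EuclideanSpace ℝ (Fin 3) → EuclideanSpace ℝ (Fin 3)}
    {u : ℝ → EuclideanSpace ℝ (Fin 3) → EuclideanSpace ℝ (Fin 3)} (h : IsKatoSolutionOn T 1 U u) :
    IsKatoSolutionOn 1 ν (rescaleData (Real.sqrt (T / ν)) (ν • U))
      (fun t y => Real.sqrt (T / ν) •
        timeRescale ν ν u (Real.sqrt (T / ν) ^ 2 * t) (Real.sqrt (T / ν) • y - 0)) := by
  have hS : MapsTo (fun t => ν * t) (Ico 0 (T / ν)) (Ico 0 T) := fun t ht => by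
    refine ⟨mul_nonneg hν.le ht.1, ?_⟩
    have h2 := ht.2
    rw [lt_div_iff₀ hν] at h2
    linarith [mul_comm t ν]
  have hK : IsKatoSolutionOn (T / ν) ν (ν • U) (timeRescale ν ν u) := by
    refine ⟨?_, h.continuousInLpOn.timeRescale ν hS, ?_, ?_⟩
    · have h1 := IsMildNSSolutionOn.timeRescale hν h.mild hS
      rwa [timeRescale_zero_force, mul_one] at h1
    · funext y
      simp [timeRescale_apply, h.initial]
    · have hm := aestronglyMeasurable_comp_stAffine_Ioo hν one_pos (0 : EuclideanSpace ℝ (Fin 3))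
        (T := T) h.aestronglyMeasurable
      have h2 : uncurry (timeRescale ν ν u) =
          fun z => ν • (uncurry u ∘ stAffine ν 1 0 (0 : EuclideanSpace ℝ (Fin 3))) z := by
        funext ⟨s, y⟩
        simp [timeRescale_apply, stAffine]
      rw [h2]
      exact hm.const_smul ν
  have hc : 0 < Real.sqrt (T / ν) := Real.sqrt_pos.2 (div_pos hT hν)
  have h1 : T / ν / Real.sqrt (T / ν) ^ 2 = 1 := by
    rw [Real.sq_sqrt (div_pos hT hν).le, div_self (div_pos hT hν).ne']
  obtain ⟨k1, k2, k3, k4⟩ := kato_local_rescale_translate hK.mild hK.continuousInLpOn hK.initial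
    hK.aestronglyMeasurable hc (0 : EuclideanSpace ℝ (Fin 3))
  rw [h1] at k1 k2 k4
  have hdat : (fun y => (ν • U) (y - 0)) = ν • U := by
    funext y
    rw [sub_zero]
  rw [hdat] at k1 k3
  exact ⟨k1, k2, k3, k4⟩

/-- **Concentration is transported by the transfer.** For `ν, T, r > 0`, `λ = √(T/ν)` and
`r' = min (√T r, λ r)`: `λ ν · ess sup_{Q_{r'}(T, x)} |u| ≤ ess sup_{Q_r(1, λ⁻¹ x)} |v|` for the
transferred field `v` (`eLpNorm_top_uncurry_rescale_translate`, then
`concentrationWeakLimit_eLpNorm_timeRescale_ge` on `Q_{r'}(T, x)`, whose pull-back lies in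
`Q_{λ r}(λ², x)`). [cite: RusinSverak2011, proof of Cor. 4.3 (arXiv:0911.0500 p. 8) with §1 (p. 3)] -/
theorem branchOfAxisym_eLpNorm_transfer_ge {ν T : ℝ} (hν : 0 < ν) (hT : 0 < T)
    (u : ℝ → EuclideanSpace ℝ (Fin 3) → EuclideanSpace ℝ (Fin 3)) (x : EuclideanSpace ℝ (Fin 3))
    {r : ℝ} (hr : 0 < r) :
    ‖Real.sqrt (T / ν)‖ₑ * ‖ν‖ₑ * eLpNorm (uncurry u) ∞ (volume.restrict
        (parabolicCylinder (min (Real.sqrt T * r) (Real.sqrt (T / ν) * r)) ((T : ℝ), x))) ≤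
      eLpNorm (uncurry fun t y => Real.sqrt (T / ν) •
          timeRescale ν ν u (Real.sqrt (T / ν) ^ 2 * t) (Real.sqrt (T / ν) • y - 0)) ∞
        (volume.restrict (parabolicCylinder r ((1 : ℝ), (Real.sqrt (T / ν))⁻¹ • x))) := by
  have hc : 0 < Real.sqrt (T / ν) := Real.sqrt_pos.2 (div_pos hT hν)
  have e1 : Real.sqrt (T / ν) ^ 2 = T / ν := Real.sq_sqrt (div_pos hT hν).le
  -- the pull-back of `Q_{r'}(T, x)` under `(s, y) ↦ (ν s, y)` lies in `Q_{λ r}(λ², x)`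
  have hpre : stAffine ν 1 0 (0 : EuclideanSpace ℝ (Fin 3)) ⁻¹'
      parabolicCylinder (min (Real.sqrt T * r) (Real.sqrt (T / ν) * r)) ((T : ℝ), x) ⊆
      parabolicCylinder (Real.sqrt (T / ν) * r) ((Real.sqrt (T / ν) ^ 2 * 1 : ℝ), x) := by
    rintro ⟨s, y⟩ hz
    simp only [mem_preimage, stAffine_apply, zero_add, one_smul, mem_parabolicCylinder] at hz
    simp only [mem_parabolicCylinder]
    obtain ⟨⟨hs1, hs2⟩, hy⟩ := hz
    have h3 : min (Real.sqrt T * r) (Real.sqrt (T / ν) * r) ^ 2 ≤ T * r ^ 2 := by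
      calc _ ≤ (Real.sqrt T * r) ^ 2 := pow_le_pow_left₀ (le_min (mul_nonneg (Real.sqrt_nonneg _) hr.le)
            (mul_nonneg hc.le hr.le)) (min_le_left _ _) 2
        _ = T * r ^ 2 := by rw [mul_pow, Real.sq_sqrt hT.le]
    refine ⟨⟨?_, ?_⟩, hy.trans_le (min_le_right _ _)⟩
    · rw [mul_one, mul_pow, e1, show T / ν - T / ν * r ^ 2 = (T - T * r ^ 2) / ν by ring,
        div_lt_iff₀ hν]
      linarith [mul_comm s ν]
    · rw [mul_one, e1, lt_div_iff₀ hν]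
      linarith [mul_comm s ν]
  rw [eLpNorm_top_uncurry_rescale_translate (timeRescale ν ν u) hc 0 r 1 _, sub_zero, smul_smul,
    mul_inv_cancel₀ hc.ne', one_smul, mul_assoc]
  exact mul_le_mul_right (concentrationWeakLimit_eLpNorm_timeRescale_ge hν u hpre) _

/-- **Classes of the transferred data.** If `gU` represents `U` with `‖gU‖ < ρ_max^pure(1)`, then
`rescaleData λ (ν • U)` (`λ > 0`) is represented by a class of norm `ν ‖gU‖ < ν ρ_max^pure(1) =
ρ_max^pure(ν)` (`exists_represents_rescaleData_norm_eq`, `represents_complexify_smul`,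
`rusinSverakRhoMaxPure_eq_mul_holds`). [cite: RusinSverak2011, §1 (arXiv:0911.0500 p. 3: scaling, unit viscosity)] -/
theorem branchOfAxisym_class_transfer {ν lam : ℝ} (hν : 0 < ν) (hlam : 0 < lam)
    {U : EuclideanSpace ℝ (Fin 3) → EuclideanSpace ℝ (Fin 3)}
    {gU : HomSobolev (EuclideanSpace ℝ (Fin 3)) (EuclideanSpace ℂ (Fin 3)) (1 / 2 : ℝ)}
    (hrep : gU.Represents (complexify ∘ U)) (hlt : ‖gU‖ₑ < rusinSverakRhoMaxPure 1) :
    ∃ G : HomSobolev (EuclideanSpace ℝ (Fin 3)) (EuclideanSpace ℂ (Fin 3)) (1 / 2 : ℝ),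
      G.Represents (complexify ∘ rescaleData lam (ν • U)) ∧ ‖G‖ₑ < rusinSverakRhoMaxPure ν := by
  obtain ⟨G, hG, hGnorm⟩ := exists_represents_rescaleData_norm_eq (ν • U) ((ν : ℂ) • gU) hlam 0
    (represents_complexify_smul hrep ν)
  have hdat : (fun y => (ν • U) (y - 0)) = ν • U := by
    funext y
    rw [sub_zero]
  rw [hdat] at hG
  refine ⟨G, hG, ?_⟩
  rw [← ofReal_norm, hGnorm, ofReal_norm, enorm_real_smul_homSobolev hν.le,
    rusinSverakRhoMaxPure_eq_mul_holds hν]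
  exact ENNReal.mul_lt_mul_right (ENNReal.ofReal_pos.2 hν).ne' ENNReal.ofReal_ne_top hlt

/-- **Stub `stub_branchOfAxisymMinimalDatum` — dominance converse of the re-typing of the
sub-threshold branch as parabolic concentration.** An exactly axisymmetric minimal blow-up datum
`(u₀, g)` at viscosity `ν > 0` yields exactly axisymmetric sub-threshold data `U k` (classes `G k`,
`‖G k‖ < ρ_max^pure(ν)`) whose Kato solutions on `[0, 1)` concentrate at points `(1, x k)`: scale to
unit viscosity (`IsMinimalBlowupDatum.inv_smul`), take the sequence of `branchOfAxisym_unit` and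
transfer it back (`branchOfAxisym_kato_transfer`, `branchOfAxisym_class_transfer`,
`branchOfAxisym_eLpNorm_transfer_ge`); the data `y ↦ λ ν c_k ν⁻¹ u₀(λ y)` are axisymmetric
(`branchOfAxisym_axisym_of_smul`). [cite: RusinSverak2011, §4 p. 6, Thm. 4.1, Thm. 4.2, proof of Cor. 4.3 (arXiv:0911.0500 pp. 6–8)] -/
theorem stub_branchOfAxisymMinimalDatum :
    ∀ ν : ℝ, 0 < ν → (∃ (u₀ : EuclideanSpace ℝ (Fin 3) → EuclideanSpace ℝ (Fin 3)) (g : Literature.Analysis.FunctionSpaces.HomSobolev (EuclideanSpace ℝ (Fin 3)) (EuclideanSpace ℂ (Fin 3)) (1 / 2 : ℝ)), Literature.Analysis.FluidPDE.IsMinimalBlowupDatum ν u₀ g ∧ ∀ (θ : ℝ) (y : EuclideanSpace ℝ (Fin 3)), u₀ (WithLp.toLp 2 ![Real.cos θ * y 0 - Real.sin θ * y 1, Real.sin θ * y 0 + Real.cos θ * y 1, y 2]) = WithLp.toLp 2 ![Real.cos θ * u₀ y 0 - Real.sin θ * u₀ y 1, Real.sin θ * u₀ y 0 + Real.cos θ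 * u₀ y 1, u₀ y 2]) → ∃ (U : ℕ → EuclideanSpace ℝ (Fin 3) → EuclideanSpace ℝ (Fin 3)) (G : ℕ → Literature.Analysis.FunctionSpaces.HomSobolev (EuclideanSpace ℝ (Fin 3)) (EuclideanSpace ℂ (Fin 3)) (1 / 2 : ℝ)) (u : ℕ → ℝ → EuclideanSpace ℝ (Fin 3) → EuclideanSpace ℝ (Fin 3)) (x : ℕ → EuclideanSpace ℝ (Fin 3)), (∀ k, MeasureTheory.MemLp (U k) 3 (MeasureTheory.volume : MeasureTheory.Measure (EuclideanSpace ℝ (Fin 3))) ∧ (G k).Represents (Literature.Analysis.FunctionSpaces.EuclideanSpace.complexify ∘ U k) ∧ Literature.Analysis.FluidPDE.IsWeaklyDivFree (U k) ∧ ‖G k‖ₑ < Literature.Analysis.FluidPDE.rusinSverakRhoMaxPure ν) ∧ (∀ k, Literature.Analysis.FluidPDE.IsMildNSSolutionOn (Set.Ico 0 1) ν 0 (U k) (u k) ∧ Literature.Analysis.FluidPDE.ContinuousInLpOn (Set.Ico 0 1) 3 (u k) ∧ u k 0 = U k ∧ MeasureTheory.AEStronglyMeasurable (Function.uncurry (u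 k)) (MeasureTheory.volume.restrict (Set.Ioo (0 : ℝ) 1 ×ˢ (Set.univ : Set (EuclideanSpace ℝ (Fin 3)))))) ∧ (∀ r : ℝ, 0 < r → Filter.Tendsto (fun k => MeasureTheory.eLpNorm (Function.uncurry (u k)) ⊤ (MeasureTheory.volume.restrict (Literature.Analysis.FluidPDE.parabolicCylinder r ((1 : ℝ), x k)))) Filter.atTop (nhds ⊤)) ∧ (∀ k (θ : ℝ) (y : EuclideanSpace ℝ (Fin 3)), U k (WithLp.toLp 2 ![Real.cos θ * y 0 - Real.sin θ * y 1, Real.sin θ * y 0 + Real.cos θ * y 1, y 2]) = WithLp.toLp 2 ![Real.cos θ * U k y 0 - Real.sin θ * U k y 1, Real.sin θ * U k y 0 + Real.cos θ * U k y 1, U k y 2]) := by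
  rintro ν hν ⟨u₀, g, hmin, hrot⟩
  -- unit viscosity: data `c_k ν⁻¹ u₀`, Kato solutions on `[0, T)` concentrating at `(T, xs)`
  obtain ⟨T, hT, xs, cseq, u₁, hdata, hkato, hconc⟩ := branchOfAxisym_unit (hmin.inv_smul hν)
  have hc : 0 < Real.sqrt (T / ν) := Real.sqrt_pos.2 (div_pos hT hν)
  choose G hG using fun k => branchOfAxisym_class_transfer hν hc (hdata k).2.1 (hdata k).2.2.2
  refine ⟨fun k => rescaleData (Real.sqrt (T / ν)) (ν • (cseq k • (ν⁻¹ • u₀))), G,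
    fun k => fun t y => Real.sqrt (T / ν) •
      timeRescale ν ν (u₁ k) (Real.sqrt (T / ν) ^ 2 * t) (Real.sqrt (T / ν) • y - 0),
    fun _ => (Real.sqrt (T / ν))⁻¹ • xs, fun k => ⟨?_, (hG k).1, ?_, (hG k).2⟩,
    fun k => branchOfAxisym_kato_transfer hν hT (hkato k), fun r hr => ?_, fun k θ y => ?_⟩
  · exact memLp_three_rescaleData ((hdata k).1.const_smul ν) hc
  · exact ((hdata k).2.2.1.const_smul ν).nsRescaleData hc
  · -- concentration at `(1, λ⁻¹ xs)`
    have hCne : (‖Real.sqrt (T / ν)‖ₑ * ‖ν‖ₑ : ℝ≥0∞) ≠ 0 :=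
      mul_ne_zero (by simpa using hc.ne') (by simpa using hν.ne')
    have hCtop : (‖Real.sqrt (T / ν)‖ₑ * ‖ν‖ₑ : ℝ≥0∞) ≠ ∞ := ENNReal.mul_ne_top enorm_ne_top enorm_ne_top
    have hr' : 0 < min (Real.sqrt T * r) (Real.sqrt (T / ν) * r) :=
      lt_min (mul_pos (Real.sqrt_pos.2 hT) hr) (mul_pos hc hr)
    have h1 := ENNReal.Tendsto.const_mul (a := ‖Real.sqrt (T / ν)‖ₑ * ‖ν‖ₑ) (hconc _ hr') (Or.inr hCtop)
    rw [ENNReal.mul_top hCne] at h1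
    exact tendsto_nhds_top_mono' h1 fun k => branchOfAxisym_eLpNorm_transfer_ge hν hT (u₁ k) xs hr
  · -- axisymmetry of `y ↦ λ ν c_k ν⁻¹ u₀ (λ y)`
    exact branchOfAxisym_axisym_of_smul hrot (Real.sqrt (T / ν) * (ν * (cseq k * ν⁻¹)))
      (Real.sqrt (T / ν)) _ (fun y' => by simp only [rescaleData_apply, Pi.smul_apply, smul_smul]) θ y

end Summit.NavierStokesRegularity.NavierStokesRegularity.Theorems

end
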